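import Literature.AlgebraicGeometry.HodgeTheory.AbelianVarietyPrimeOrderAutomorphismRotationNumberFormula
import Literature.AlgebraicGeometry.HodgeTheory.AbelianVarietyAnalyticTypeProductsPowers
import HarnessLib

/-!
# The Jacobian range of Zarhin's multiplicity function: `𝐚(−v) ≤ (p−1)𝐚(v) + p − 2` for every prime `p`, and order three —
# `3(𝐚(1)+1) = 2𝐛(1) + 𝐛(2)`, `3(𝐚(2)+1) = 𝐛(1) + 2𝐛(2)`, the rotation numbers are determined by the multiplicities,
# `𝐛(1) ≡ 𝐛(2) mod 3`, `g ≤ 3𝐚(h) + 1` (Zarhin, Thm. 1.4, Cor. 1.13 and Example 2.2)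

Family `hodge`, lane `lit-hodgefound` (seat p03, GEN 35 «the analytic type of a finite-order automorphism», row g35-#7; sequel of
g35-#6 `AbelianVarietyPrimeOrderAutomorphismRotationNumberFormula` and g35-#5 `AbelianVarietyAnalyticTypeProductsPowers`), topic
`Literature/AlgebraicGeometry/HodgeTheory`.  Theorems only: no definition, no instance, no named fact (net Literature debt 0).

For every prime `p` the formula `p(𝐚(v)+1) = Σ_u 𝐛(u) 𝐣(u⁻¹(−v))` with `𝐛 ≥ 0` and `1 ≤ 𝐣 ≤ p − 1` pins `𝐚` to the
JACOBIAN RANGE `𝐚(−v) + 2 ≤ (p−1)𝐚(v) + p` (§0: `Σ_u 𝐛(u) = 𝐚(v) + 𝐚(−v) + 2 ≤ p(𝐚(v)+1)`), a necessary condition on the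
multiplicities of a Jacobian with a `μ_p`-action under Theorem 1.4.
For `p = 3` the group `G = (ℤ/3ℤ)^* = {1, 2} = {1, −1}` has two elements and Zarhin's formula
`𝐚(v) = ((p−1)/p)·(𝐛 ∗ 𝐣)(−v) − 1` (g35-#6 `prime_mul_add_one_eq_sum_of_lefschetz`: `p(𝐚(v)+1) = Σ_u 𝐛(u) 𝐣(u⁻¹(−v))`)
reads `𝐚(1) = (2𝐛(1) + 𝐛(2))/3 − 1`, `𝐚(2) = (𝐛(1) + 2𝐛(2))/3 − 1` (Example 2.2).  Consequently `𝐛` is determined by `𝐚`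
(`𝐛(1) = 2𝐚(1) − 𝐚(2) + 1`, `𝐛(2) = 2𝐚(2) − 𝐚(1) + 1`: Corollary 1.13, «if `p = 3` then `𝐛′(v) = 𝐛(v)`»), the congruence
`𝐛(1) ≡ 𝐛(2) mod 3` is automatic, and NONNEGATIVITY of `𝐛` is the whole content of Theorem 1.4 at `p = 3`:
`𝐚(2) ≤ 2𝐚(1) + 1`, `𝐚(1) ≤ 2𝐚(2) + 1`, i.e. with `𝐚(1) + 𝐚(2) = g`: `g ≤ 3𝐚(1) + 1` and `g ≤ 3𝐚(2) + 1` — exactly the ranges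
`𝐚(1) = k + d (0 ≤ d ≤ k+1)` for `g = 3k+1`, `𝐚(1) = (k+1) + d (0 ≤ d ≤ k)` for `g = 3k+2`, `𝐚(1) = k + d (0 ≤ d ≤ k)` for `g = 3k` of
Example 2.2.  §2 specialises to the analytic type `(n_ω(δ), n_{ω²}(δ))` of an endomorphism with `Φ_3(δ) = 0` and §3 to Zarhin's
`Y = E^{f(1)} × E^{f(2)}` of Example 1.3 (g35-#5): when `2f(1) + 1 < f(2)` no nonnegative rotation-number function `𝐛` satisfies
the Lefschetz identity for `δ_3` — the formal shape of «(Y, λ_Y) is not a jacobian» granted Torelli + holomorphic Lefschetz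
(the hypothesis `hL`, as in g35-#6).

## Sources, verbatim (held text `paper:arxiv-2109.06794`)

Yu. G. Zarhin, *Jacobians with automorphisms of prime order*, Math. Research Reports (2021) = arXiv:2109.06794:
§1 (chunk p0005 L40–L58) «**Corollary 1.13.** We keep the notation and assumptions of Theorem 1.4. Let `𝐛′ : G → ℂ` be a
complex-valued function on `G` such that `𝐚(v) = ((p−1)/p)·𝐛′ ∗ 𝐣(−v) − 1`. Then the odd parts of functions `𝐛` and `𝐛′` do
coincide […] In particular, if `p = 3` then `𝐛′(v) = 𝐛(v) ∀ v ∈ G`»; (L100–L110, its proof for `p = 3`) «Then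
`2 + 2g/(p−1) = g + 2` and `G = {1, −1}` […] `𝐛′(1) + 𝐛′(−1) = g + 2 = 𝐛(1) + 𝐛(−1)`»; §2 (chunk p0006 L158–L170) «**Example 2.2.**
Let `p = 3`. The number of admissible functions is `(g+1)`. […] `G = (ℤ/3ℤ)^* = {1 mod 3, 2 mod 3}` […] We have the following
conditions on `𝐛`: `𝐛(1), 𝐛(2) ∈ ℤ_+`, `𝐛(1) + 𝐛(2) = g + 2`, `3 ∣ (𝐛(1) + 2𝐛(2))`. The congruence condition means that
`𝐛(1) ≡ 𝐛(2) mod 3`»; (L185–L200, chunk p0007 L1–L95) «`𝐚(2) = (1/3)(𝐛(1) + 2𝐛(2)) − 1`, `𝐚(1) = (1/3)(2𝐛(1) + 𝐛(2)) − 1` […]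
(i) `g = 3k+1`: `𝐚(1) = k + d, 𝐚(2) = (2k+1) − d; d = 0, …, k+1` […] (ii) `g = 3k+2`: `𝐚(1) = (k+1) + d, 𝐚(2) = (2k+1) − d;
d = 0, …, k` […] (iii) `g = 3k`: `𝐚(1) = k + d, 𝐚(2) = 2k − d; d = 0, …, k`»; §1 (chunk p0003 L88–L104) Example 1.3
(`Y = E^{f(1)} × E^{f(2)}`, `𝐚_Y(1) = f(1)`, `𝐚_Y(2) = f(2)`).

## What is proved

Namespace `Literature.AlgebraicGeometry.HodgeTheory.PrimeOrderRotation` (`K` a field of characteristic `0`, `ζ ∈ K` a primitive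
`p`-th (§0) resp. cube (§1) root of unity, `𝐚, 𝐛 : G → ℚ` resp. `→ ℕ` bound by the Lefschetz identity `hL` of g35-#6):
* §0 (any prime `p`) `sum_eq_add_add_two_of_lefschetz_nat` (`Σ_u 𝐛(u) = 𝐚(v) + 𝐚(−v) + 2` in `ℕ`),
  **`add_two_le_of_lefschetz_nat`** (`𝐚(−v) + 2 ≤ (p−1)·𝐚(v) + p`, i.e. `𝐚(−v) ≤ (p−1)𝐚(v) + p − 2`, from `𝐣 ≥ 1`).
* §1 `neg_one_ne_one_units_zmod_three`, `univ_units_zmod_three` (`G = {1, −1}`), **`sum_units_zmod_three`** (`Σ_u f(u) = f(1) + f(−1)`),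
  `val_one_units_zmod_three`, `val_neg_one_units_zmod_three` (`𝐣(1) = 1`, `𝐣(−1) = 2`);
  **`three_mul_add_one_eq_of_lefschetz`** (`3(𝐚(1)+1) = 2𝐛(1) + 𝐛(−1) ∧ 3(𝐚(−1)+1) = 𝐛(1) + 2𝐛(−1)`, Example 2.2),
  **`eq_of_lefschetz_three`** (`𝐛(1) = 2𝐚(1) − 𝐚(−1) + 1 ∧ 𝐛(−1) = 2𝐚(−1) − 𝐚(1) + 1`: Cor. 1.13 for `p = 3`, `𝐛` is unique),
  `three_mul_add_one_eq_of_lefschetz_nat`, **`le_of_lefschetz_three`** (`ℕ`-valued: `𝐚(−1) ≤ 2𝐚(1) + 1 ∧ 𝐚(1) ≤ 2𝐚(−1) + 1`),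
  **`modEq_of_lefschetz_three`** (`𝐛(1) ≡ 𝐛(−1) [MOD 3]`), `add_eq_of_lefschetz_three` (`𝐛(1) + 𝐛(−1) = 𝐚(1) + 𝐚(−1) + 2 = g + 2`).
* §2 (namespace `…HodgeTheory.AbelianVariety`; `δ : A ⟶ A`, `Φ_p(δ) = 0` resp. `Φ_3(δ) = 0`, `ζ`/`ω` primitive, `𝐛 : G → ℕ` with
  `1 − τ̄ = Σ_u 𝐛(u)/(1 − ζ^u)`): **`eigenMultiplicity_neg_add_two_le_of_lefschetz`** (any `p`:
  `n_{ζ^{−v}}(δ) + 2 ≤ (p−1)·n_{ζ^v}(δ) + p`), `add_eigenMultiplicity_sq_eq_dim` (`n_ω + n_{ω²} = g`),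
  **`three_mul_eigenMultiplicity_add_one_eq_of_lefschetz`** (`3(n_ω+1) = 2𝐛(1) + 𝐛(−1) ∧ 3(n_{ω²}+1) = 𝐛(1) + 2𝐛(−1)`),
  **`dim_le_of_lefschetz_three`** (`g ≤ 3 n_ω + 1 ∧ g ≤ 3 n_{ω²} + 1`), **`not_exists_lefschetz_of_lt`**
  (`3 n_ω(δ) + 1 < g ⇒` no `𝐛 : G → ℕ` satisfies the Lefschetz identity).
* §3 `zarhinExample_not_exists_lefschetz`: for `Y = ⨁_ι E` with `δ_Y = (δ_E on s = true, δ_E² on s = false)`, `dim E = 1`,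
  `n_ω(δ_E) = 1`: if `3·#{s = true} + 1 < |ι|` then no `𝐛 : G → ℕ` satisfies the Lefschetz identity for `δ_Y`.

## References

* [Zarhin2021PrimeOrderJacobians] Yu. G. Zarhin, Math. Research Reports (2021), arXiv:2109.06794, §1 Example 1.3, Thm. 1.4,
  Cor. 1.13; §2 Example 2.2 (chunks p0003, p0005–p0007).
* [AtiyahBott1968] M. F. Atiyah, R. Bott, Ann. of Math. 88 (1968) — Zarhin's [AT]: the holomorphic Lefschetz identity, the
  hypothesis `hL` (not proved here).
-/

noncomputable section

open Polynomial

namespace Literature.AlgebraicGeometry.HodgeTheory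

namespace PrimeOrderRotation

/-! ## §0 Any prime `p`: the Jacobian range `𝐚(−v) + 2 ≤ (p − 1)·𝐚(v) + p` -/

section AnyPrime

variable {K : Type*} [Field K] [CharZero K] {p : ℕ} [hp : Fact p.Prime] {ζ : K}

/-- **`Σ_{u ∈ G} 𝐛(u) = 𝐚(v) + 𝐚(−v) + 2` in `ℕ`** (g35-#6 `sum_eq_add_add_two_of_lefschetz` for `ℤ_+`-valued `𝐚, 𝐛`; `= 2g/(p−1) + 2`,
Cor. 1.8). [cite: Zarhin2021PrimeOrderJacobians, §1 Cor. 1.8, Prop. 1.11 (1.11) (chunk p0004 L44–L52, L113–L121)] -/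
theorem sum_eq_add_add_two_of_lefschetz_nat (hζ : IsPrimitiveRoot ζ p) (a b : (ZMod p)ˣ → ℕ)
    (hL : 1 - ∑ h : (ZMod p)ˣ, (a h : K) * ζ ^ ((-h : (ZMod p)ˣ) : ZMod p).val =
      ∑ u : (ZMod p)ˣ, (b u : K) / (1 - ζ ^ (u : ZMod p).val)) (v : (ZMod p)ˣ) :
    ∑ u : (ZMod p)ˣ, b u = a v + a (-v) + 2 := by
  have h := sum_eq_add_add_two_of_lefschetz hζ (fun h ↦ (a h : ℚ)) (fun u ↦ (b u : ℚ))
    (by simpa only [Rat.cast_natCast] using hL) v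
  exact_mod_cast h

/-- **The Jacobian range: `𝐚(−v) + 2 ≤ (p − 1)·𝐚(v) + p`, i.e. `𝐚(−v) ≤ (p−1)𝐚(v) + p − 2`, for every `v ∈ G`** whenever some
`𝐛 : G → ℤ_+` satisfies (1.9) — since `𝐣 ≥ 1`, `p(𝐚(v)+1) = Σ_u 𝐛(u)𝐣(u⁻¹(−v)) ≥ Σ_u 𝐛(u) = 𝐚(v) + 𝐚(−v) + 2` (for `p = 3`:
`𝐚(2) ≤ 2𝐚(1) + 1`, Example 2.2). A necessary condition on the multiplicities of a Jacobian under Theorem 1.4 («certain natural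
conditions on the multiplicities […] do guarantee that those polarized varieties are not jacobians of curves»).
[cite: Zarhin2021PrimeOrderJacobians, Abstract (chunk p0002), §1 Thm. 1.4, Prop. 1.11 (chunk p0003 L131–L147, p0004 L113–L152), §2 Example 2.2 (chunk p0007)] -/
theorem add_two_le_of_lefschetz_nat (hζ : IsPrimitiveRoot ζ p) (a b : (ZMod p)ˣ → ℕ)
    (hL : 1 - ∑ h : (ZMod p)ˣ, (a h : K) * ζ ^ ((-h : (ZMod p)ˣ) : ZMod p).val =
      ∑ u : (ZMod p)ˣ, (b u : K) / (1 - ζ ^ (u : ZMod p).val)) (v : (ZMod p)ˣ) :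
    a (-v) + 2 ≤ (p - 1) * a v + p := by
  have h1 := prime_mul_add_one_eq_sum_of_lefschetz_nat hζ a b hL v
  have h2 := sum_eq_add_add_two_of_lefschetz_nat hζ a b hL v
  have h3 : ∑ u : (ZMod p)ˣ, b u ≤ ∑ u : (ZMod p)ˣ, b u * ((u⁻¹ * -v : (ZMod p)ˣ) : ZMod p).val :=
    Finset.sum_le_sum fun u _ ↦ Nat.le_mul_of_pos_right _ (Nat.pos_of_ne_zero (val_units_ne_zero _))
  rw [mul_add, mul_one] at h1
  have h4 : (p - 1) * a v = p * a v - a v := Nat.sub_one_mul p (a v)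
  have h5 : a v ≤ p * a v := Nat.le_mul_of_pos_left _ hp.out.pos
  omega

end AnyPrime

/-! ## §1 `G = (ℤ/3ℤ)^* = {1, −1}` and Zarhin's formula at `p = 3` -/

section Three

variable {K : Type*} [Field K] [CharZero K] {ζ : K}

/-- `−1 ≠ 1` in `(ℤ/3ℤ)^*` («`G = {1, −1}`»). [cite: Zarhin2021PrimeOrderJacobians, §1 proof of Cor. 1.13 (chunk p0005 L100–L104)] -/
theorem neg_one_ne_one_units_zmod_three : (-1 : (ZMod 3)ˣ) ≠ 1 := by decide

/-- **`(ℤ/3ℤ)^* = {1, −1}`** («Now let `p = 3`. Then […] `G = {1, −1}`»). [cite: Zarhin2021PrimeOrderJacobians, §1 proof of Cor. 1.13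
(chunk p0005 L100–L104)] -/
theorem univ_units_zmod_three : (Finset.univ : Finset (ZMod 3)ˣ) = {1, -1} := by
  symm
  apply Finset.eq_univ_of_card
  rw [Finset.card_pair neg_one_ne_one_units_zmod_three.symm, ZMod.card_units_eq_totient 3,
    Nat.totient_prime Nat.prime_three]

/-- `Σ_{u ∈ G} f(u) = f(1) + f(−1)` for `G = (ℤ/3ℤ)^*`. [cite: Zarhin2021PrimeOrderJacobians, §1 proof of Cor. 1.13 (chunk p0005 L100–L110)] -/
theorem sum_units_zmod_three {M : Type*} [AddCommMonoid M] (f : (ZMod 3)ˣ → M) : ∑ u : (ZMod 3)ˣ, f u = f 1 + f (-1) := by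
  rw [univ_units_zmod_three, Finset.sum_pair neg_one_ne_one_units_zmod_three.symm]

/-- `𝐣(1 mod 3) = 1`. [cite: Zarhin2021PrimeOrderJacobians, §2 Example 2.2 (chunk p0006 L162–L165)] -/
theorem val_one_units_zmod_three : ((1 : (ZMod 3)ˣ) : ZMod 3).val = 1 := by decide

/-- `𝐣(−1 mod 3) = 𝐣(2 mod 3) = 2` («identify `G = (ℤ/3ℤ)^* = {1 mod 3, 2 mod 3}` with the set `{1, 2}`»).
[cite: Zarhin2021PrimeOrderJacobians, §2 Example 2.2 (chunk p0006 L162–L165)] -/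
theorem val_neg_one_units_zmod_three : ((-1 : (ZMod 3)ˣ) : ZMod 3).val = 2 := by decide

/-- **Example 2.2 (Zarhin), `p = 3`: `3(𝐚(1) + 1) = 2𝐛(1) + 𝐛(2)` and `3(𝐚(2) + 1) = 𝐛(1) + 2𝐛(2)`** for any `𝐚, 𝐛 : G → ℚ` bound by
the Lefschetz identity («`𝐚(2) = (1/3)(𝐛(1) + 2𝐛(2)) − 1`, `𝐚(1) = (1/3)(2𝐛(1) + 𝐛(2)) − 1`»; `2 mod 3 = −1`).
[cite: Zarhin2021PrimeOrderJacobians, §2 Example 2.2 (chunk p0006 L185–L195, p0007 L1–L10)] -/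
theorem three_mul_add_one_eq_of_lefschetz (hζ : IsPrimitiveRoot ζ 3) (a b : (ZMod 3)ˣ → ℚ)
    (hL : 1 - ∑ h : (ZMod 3)ˣ, (a h : K) * ζ ^ ((-h : (ZMod 3)ˣ) : ZMod 3).val =
      ∑ u : (ZMod 3)ˣ, (b u : K) / (1 - ζ ^ (u : ZMod 3).val)) :
    3 * (a 1 + 1) = 2 * b 1 + b (-1) ∧ 3 * (a (-1) + 1) = b 1 + 2 * b (-1) := by
  have h1 := prime_mul_add_one_eq_sum_of_lefschetz hζ a b hL 1
  have h2 := prime_mul_add_one_eq_sum_of_lefschetz hζ a b hL (-1)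
  rw [sum_units_zmod_three] at h1 h2
  simp only [inv_one, inv_neg_one, neg_neg, one_mul, mul_one, neg_one_mul, val_one_units_zmod_three,
    val_neg_one_units_zmod_three, Nat.cast_one, Nat.cast_ofNat] at h1 h2
  constructor
  · linear_combination h1
  · linear_combination h2

/-- **Corollary 1.13 for `p = 3` (Zarhin): the rotation-number function is determined by the multiplicities —
`𝐛(1) = 2𝐚(1) − 𝐚(2) + 1`, `𝐛(2) = 2𝐚(2) − 𝐚(1) + 1`** («In particular, if `p = 3` then `𝐛′(v) = 𝐛(v) ∀ v ∈ G`»: any two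
functions `𝐛, 𝐛′` satisfying (1.9) with the same `𝐚` coincide, because both equal this expression).
[cite: Zarhin2021PrimeOrderJacobians, §1 Cor. 1.13 (chunk p0005 L40–L58, L100–L110)] -/
theorem eq_of_lefschetz_three (hζ : IsPrimitiveRoot ζ 3) (a b : (ZMod 3)ˣ → ℚ)
    (hL : 1 - ∑ h : (ZMod 3)ˣ, (a h : K) * ζ ^ ((-h : (ZMod 3)ˣ) : ZMod 3).val =
      ∑ u : (ZMod 3)ˣ, (b u : K) / (1 - ζ ^ (u : ZMod 3).val)) :
    b 1 = 2 * a 1 - a (-1) + 1 ∧ b (-1) = 2 * a (-1) - a 1 + 1 := by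
  obtain ⟨h1, h2⟩ := three_mul_add_one_eq_of_lefschetz hζ a b hL
  constructor
  · linear_combination (h2 - 2 * h1) / 3
  · linear_combination (h1 - 2 * h2) / 3

/-- **Corollary 1.13, uniqueness form: two functions `𝐛, 𝐛′` bound to the same `𝐚` by the Lefschetz identity coincide** (`p = 3`).
[cite: Zarhin2021PrimeOrderJacobians, §1 Cor. 1.13 (chunk p0005 L40–L58, L100–L110)] -/
theorem eq_of_lefschetz_three' (hζ : IsPrimitiveRoot ζ 3) (a b b' : (ZMod 3)ˣ → ℚ)
    (hL : 1 - ∑ h : (ZMod 3)ˣ, (a h : K) * ζ ^ ((-h : (ZMod 3)ˣ) : ZMod 3).val =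
      ∑ u : (ZMod 3)ˣ, (b u : K) / (1 - ζ ^ (u : ZMod 3).val))
    (hL' : 1 - ∑ h : (ZMod 3)ˣ, (a h : K) * ζ ^ ((-h : (ZMod 3)ˣ) : ZMod 3).val =
      ∑ u : (ZMod 3)ˣ, (b' u : K) / (1 - ζ ^ (u : ZMod 3).val)) :
    b' = b := by
  obtain ⟨h1, h2⟩ := eq_of_lefschetz_three hζ a b hL
  obtain ⟨h1', h2'⟩ := eq_of_lefschetz_three hζ a b' hL'
  funext u
  have hu : u = 1 ∨ u = -1 := by
    have h := Finset.mem_univ u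
    rw [univ_units_zmod_three, Finset.mem_insert, Finset.mem_singleton] at h
    exact h
  rcases hu with rfl | rfl
  · rw [h1, h1']
  · rw [h2, h2']

/-- **Example 2.2 for nonnegative-integer-valued `𝐚, 𝐛`: `3(𝐚(1) + 1) = 2𝐛(1) + 𝐛(2)`, `3(𝐚(2) + 1) = 𝐛(1) + 2𝐛(2)` in `ℕ`.**
[cite: Zarhin2021PrimeOrderJacobians, §2 Example 2.2 (chunk p0006 L185–L195, p0007 L1–L10)] -/
theorem three_mul_add_one_eq_of_lefschetz_nat (hζ : IsPrimitiveRoot ζ 3) (a b : (ZMod 3)ˣ → ℕ)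
    (hL : 1 - ∑ h : (ZMod 3)ˣ, (a h : K) * ζ ^ ((-h : (ZMod 3)ˣ) : ZMod 3).val =
      ∑ u : (ZMod 3)ˣ, (b u : K) / (1 - ζ ^ (u : ZMod 3).val)) :
    3 * (a 1 + 1) = 2 * b 1 + b (-1) ∧ 3 * (a (-1) + 1) = b 1 + 2 * b (-1) := by
  obtain ⟨h1, h2⟩ := three_mul_add_one_eq_of_lefschetz hζ (fun h ↦ (a h : ℚ)) (fun u ↦ (b u : ℚ))
    (by simpa only [Rat.cast_natCast] using hL)
  exact ⟨by exact_mod_cast h1, by exact_mod_cast h2⟩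

/-- **Theorem 1.4 at `p = 3`, the whole constraint: `𝐚(2) ≤ 2𝐚(1) + 1` and `𝐚(1) ≤ 2𝐚(2) + 1`** — nonnegativity of
`𝐛(1) = 2𝐚(1) − 𝐚(2) + 1` and `𝐛(2) = 2𝐚(2) − 𝐚(1) + 1` (Example 2.2's lists: `𝐚(1) = k + d`, `0 ≤ d ≤ k (+1)`).
[cite: Zarhin2021PrimeOrderJacobians, §1 Thm. 1.4, §2 Example 2.2 (chunk p0003 L131–L147, p0007 L1–L95)] -/
theorem le_of_lefschetz_three (hζ : IsPrimitiveRoot ζ 3) (a b : (ZMod 3)ˣ → ℕ)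
    (hL : 1 - ∑ h : (ZMod 3)ˣ, (a h : K) * ζ ^ ((-h : (ZMod 3)ˣ) : ZMod 3).val =
      ∑ u : (ZMod 3)ˣ, (b u : K) / (1 - ζ ^ (u : ZMod 3).val)) :
    a (-1) ≤ 2 * a 1 + 1 ∧ a 1 ≤ 2 * a (-1) + 1 := by
  obtain ⟨h1, h2⟩ := three_mul_add_one_eq_of_lefschetz_nat hζ a b hL
  omega

/-- **Example 2.2: `𝐛(1) ≡ 𝐛(2) mod 3`** («`3 ∣ (𝐛(1) + 2𝐛(2))`. The congruence condition means that `𝐛(1) ≡ 𝐛(2) mod 3`»).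
[cite: Zarhin2021PrimeOrderJacobians, §2 Example 2.2 (chunk p0006 L166–L172)] -/
theorem modEq_of_lefschetz_three (hζ : IsPrimitiveRoot ζ 3) (a b : (ZMod 3)ˣ → ℕ)
    (hL : 1 - ∑ h : (ZMod 3)ˣ, (a h : K) * ζ ^ ((-h : (ZMod 3)ˣ) : ZMod 3).val =
      ∑ u : (ZMod 3)ˣ, (b u : K) / (1 - ζ ^ (u : ZMod 3).val)) :
    b 1 ≡ b (-1) [MOD 3] := by
  obtain ⟨h1, h2⟩ := three_mul_add_one_eq_of_lefschetz_nat hζ a b hL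
  show b 1 % 3 = b (-1) % 3
  omega

/-- **Example 2.2 / Cor. 1.8 at `p = 3`: `𝐛(1) + 𝐛(2) = 𝐚(1) + 𝐚(2) + 2 = g + 2`** («`𝐛(1) + 𝐛(2) = g + 2`»).
[cite: Zarhin2021PrimeOrderJacobians, §2 Example 2.2 (chunk p0006 L166–L168), §1 proof of Cor. 1.13 (chunk p0005 L106–L110)] -/
theorem add_eq_of_lefschetz_three (hζ : IsPrimitiveRoot ζ 3) (a b : (ZMod 3)ˣ → ℕ)
    (hL : 1 - ∑ h : (ZMod 3)ˣ, (a h : K) * ζ ^ ((-h : (ZMod 3)ˣ) : ZMod 3).val =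
      ∑ u : (ZMod 3)ˣ, (b u : K) / (1 - ζ ^ (u : ZMod 3).val)) :
    b 1 + b (-1) = a 1 + a (-1) + 2 := by
  obtain ⟨h1, h2⟩ := three_mul_add_one_eq_of_lefschetz_nat hζ a b hL
  omega

end Three

end PrimeOrderRotation

/-! ## §2 The analytic type: the Jacobian range for any `p`, and `(n_ω(δ), n_{ω²}(δ))` for `Φ_3(δ) = 0` -/

namespace AbelianVariety

open CategoryTheory CategoryTheory.Limits PrimeOrderRotation

section AnyPrimeAV

variable {A : Motives.AbelianVariety ℂ} {δ : A ⟶ A} {p : ℕ} [hp : Fact p.Prime] {ζ : ℂ}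

/-- **The Jacobian range for the analytic type: `n_{ζ^{−v}}(δ) + 2 ≤ (p − 1)·n_{ζ^v}(δ) + p` for every `v ∈ G`** whenever some
`𝐛 : G → ℕ` satisfies the Lefschetz identity `1 − τ̄ = Σ_u 𝐛(u)/(1 − ζ^u)` (`τ = Tr_a(δ)`, `Φ_p(δ) = 0`).
[cite: Zarhin2021PrimeOrderJacobians, §1 Thm. 1.4, Prop. 1.11 (chunk p0003 L131–L147, p0004 L113–L152)] -/
theorem eigenMultiplicity_neg_add_two_le_of_lefschetz
    (hδ : (cyclotomic p ℤ).eval₂ (Int.castRingHom (End A)) (End.of δ) = 0) (hζ : IsPrimitiveRoot ζ p)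
    (b : (ZMod p)ˣ → ℕ)
    (hL : 1 - starRingEnd ℂ (LinearMap.trace ℂ (Motives.AbelianVariety.Lie A) (Motives.AbelianVariety.lieMap A δ)) =
      ∑ u : (ZMod p)ˣ, (b u : ℂ) / (1 - ζ ^ (u : ZMod p).val)) (v : (ZMod p)ˣ) :
    eigenMultiplicity A δ (ζ ^ ((-v : (ZMod p)ˣ) : ZMod p).val) + 2 ≤
      (p - 1) * eigenMultiplicity A δ (ζ ^ (v : ZMod p).val) + p := by
  rw [conj_trace_lieMap_eq_sum_units hδ hζ] at hL
  exact add_two_le_of_lefschetz_nat hζ (fun h ↦ eigenMultiplicity A δ (ζ ^ (h : ZMod p).val)) b hL v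

end AnyPrimeAV

section OrderThree

variable {A : Motives.AbelianVariety ℂ} {δ : A ⟶ A} {ω : ℂ}

/-- **`n_ω(δ) + n_{ω²}(δ) = dim A`** for `Φ_3(δ) = 0` («`f(1)` and `f(−1)` are nonnegative integers, whose sum is `g`»;
(1.2) at `p = 3`). [cite: Zarhin2021PrimeOrderJacobians, §1 (1.2), Example 1.3 (chunk p0003 L47, L96–L99)] -/
theorem add_eigenMultiplicity_sq_eq_dim (hδ : (cyclotomic 3 ℤ).eval₂ (Int.castRingHom (End A)) (End.of δ) = 0)
    (hω : IsPrimitiveRoot ω 3) :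
    eigenMultiplicity A δ ω + eigenMultiplicity A δ (ω ^ 2) = A.dim := by
  have h := add_eigenMultiplicity_pow_sub_mul_eq hδ hω (j := 1) (Finset.mem_Ico.2 ⟨le_rfl, by norm_num⟩)
  rw [pow_one, show 3 - 1 = 2 from rfl] at h
  omega

/-- **Example 2.2 for the analytic type: `3(n_ω(δ) + 1) = 2𝐛(1) + 𝐛(2)` and `3(n_{ω²}(δ) + 1) = 𝐛(1) + 2𝐛(2)`** whenever
`𝐛 : (ℤ/3ℤ)^* → ℕ` satisfies the Lefschetz identity `1 − τ̄ = Σ_u 𝐛(u)/(1 − ω^u)` for `τ = Tr_a(δ)`.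
[cite: Zarhin2021PrimeOrderJacobians, §2 Example 2.2 (chunk p0006 L185–L195), §1 Prop. 1.11 (chunk p0004 L113–L121)] -/
theorem three_mul_eigenMultiplicity_add_one_eq_of_lefschetz
    (hδ : (cyclotomic 3 ℤ).eval₂ (Int.castRingHom (End A)) (End.of δ) = 0) (hω : IsPrimitiveRoot ω 3)
    (b : (ZMod 3)ˣ → ℕ)
    (hL : 1 - starRingEnd ℂ (LinearMap.trace ℂ (Motives.AbelianVariety.Lie A) (Motives.AbelianVariety.lieMap A δ)) =
      ∑ u : (ZMod 3)ˣ, (b u : ℂ) / (1 - ω ^ (u : ZMod 3).val)) :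
    3 * (eigenMultiplicity A δ ω + 1) = 2 * b 1 + b (-1) ∧
      3 * (eigenMultiplicity A δ (ω ^ 2) + 1) = b 1 + 2 * b (-1) := by
  rw [conj_trace_lieMap_eq_sum_units hδ hω] at hL
  have h := three_mul_add_one_eq_of_lefschetz_nat hω (fun h ↦ eigenMultiplicity A δ (ω ^ (h : ZMod 3).val)) b hL
  rw [val_one_units_zmod_three, val_neg_one_units_zmod_three, pow_one] at h
  exact h

/-- **Theorem 1.4 at `p = 3`, as a bound: `dim A ≤ 3 n_ω(δ) + 1` and `dim A ≤ 3 n_{ω²}(δ) + 1`** whenever some `𝐛 : G → ℕ`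
satisfies the Lefschetz identity (Example 2.2's ranges `𝐚(1), 𝐚(2) ≥ k` for `g ∈ {3k, 3k+1}`, `≥ k+1` for `g = 3k+2`).
[cite: Zarhin2021PrimeOrderJacobians, §1 Thm. 1.4 (chunk p0003 L131–L147), §2 Example 2.2 (chunk p0007 L1–L95)] -/
theorem dim_le_of_lefschetz_three
    (hδ : (cyclotomic 3 ℤ).eval₂ (Int.castRingHom (End A)) (End.of δ) = 0) (hω : IsPrimitiveRoot ω 3)
    (b : (ZMod 3)ˣ → ℕ)
    (hL : 1 - starRingEnd ℂ (LinearMap.trace ℂ (Motives.AbelianVariety.Lie A) (Motives.AbelianVariety.lieMap A δ)) =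
      ∑ u : (ZMod 3)ˣ, (b u : ℂ) / (1 - ω ^ (u : ZMod 3).val)) :
    A.dim ≤ 3 * eigenMultiplicity A δ ω + 1 ∧ A.dim ≤ 3 * eigenMultiplicity A δ (ω ^ 2) + 1 := by
  obtain ⟨h1, h2⟩ := three_mul_eigenMultiplicity_add_one_eq_of_lefschetz hδ hω b hL
  have h3 := add_eigenMultiplicity_sq_eq_dim hδ hω
  omega

/-- **No rotation-number function when `3 n_ω(δ) + 1 < dim A`:** then NO `𝐛 : (ℤ/3ℤ)^* → ℕ` satisfies the Lefschetz identity
`1 − τ̄ = Σ_u 𝐛(u)/(1 − ω^u)` — by Theorem 1.4 (whose geometric half, Torelli + holomorphic Lefschetz, produces such a `𝐛`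
for a Jacobian) the formal content of «(X, λ) is not a jacobian» for `p = 3` («certain natural conditions on the multiplicities
[…] do guarantee that those polarized varieties are not jacobians of curves»).
[cite: Zarhin2021PrimeOrderJacobians, Abstract (chunk p0002), §1 Thm. 1.4 (chunk p0003 L131–L147), §2 Example 2.2 (chunk p0007)] -/
theorem not_exists_lefschetz_of_lt
    (hδ : (cyclotomic 3 ℤ).eval₂ (Int.castRingHom (End A)) (End.of δ) = 0) (hω : IsPrimitiveRoot ω 3)
    (hlt : 3 * eigenMultiplicity A δ ω + 1 < A.dim) :
    ¬ ∃ b : (ZMod 3)ˣ → ℕ,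
      1 - starRingEnd ℂ (LinearMap.trace ℂ (Motives.AbelianVariety.Lie A) (Motives.AbelianVariety.lieMap A δ)) =
        ∑ u : (ZMod 3)ˣ, (b u : ℂ) / (1 - ω ^ (u : ZMod 3).val) := by
  rintro ⟨b, hL⟩
  have h := (dim_le_of_lefschetz_three hδ hω b hL).1
  omega

end OrderThree

/-! ## §3 Zarhin's `Y = E^{f(1)} × E^{f(2)}`: no rotation numbers when `2 f(1) + 1 < f(2)` -/

section ZarhinExample

variable {E : Motives.AbelianVariety ℂ} {δE : E ⟶ E} {ι : Type} [Fintype ι] {ω : ℂ}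

/-- **Example 1.3 × Theorem 1.4 (`p = 3`): for `Y = E^{f(1)} × E^{f(2)}` with `δ_3 = (δ_E, …, δ_E⁻¹, …)` (`E` the `ℤ[ζ_3]`-curve:
`dim E = 1`, `n_ω(δ_E) = 1`), if `3 f(1) + 1 < f(1) + f(2)` then no `𝐛 : (ℤ/3ℤ)^* → ℕ` satisfies the Lefschetz identity for
`δ_3`** — `𝐚_Y = (f(1), f(2))` lies outside Example 2.2's Jacobian range.
[cite: Zarhin2021PrimeOrderJacobians, §1 Example 1.3 (chunk p0003 L88–L104), Thm. 1.4, §2 Example 2.2 (chunk p0007)] -/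
theorem zarhinExample_not_exists_lefschetz (s : ι → Bool) (hE : E.dim = 1)
    (hδE : (cyclotomic 3 ℤ).eval₂ (Int.castRingHom (End E)) (End.of δE) = 0) (hω : IsPrimitiveRoot ω 3)
    (h1 : eigenMultiplicity E δE ω = 1)
    (hlt : 3 * (Finset.univ.filter fun j ↦ s j = true).card + 1 < Fintype.card ι) :
    ¬ ∃ b : (ZMod 3)ˣ → ℕ,
      1 - starRingEnd ℂ (LinearMap.trace ℂ (Motives.AbelianVariety.Lie (⨁ fun _ : ι ↦ E))
          (Motives.AbelianVariety.lieMap (⨁ fun _ : ι ↦ E) (biproduct.map fun j : ι ↦ if s j then δE else δE ≫ δE))) =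
        ∑ u : (ZMod 3)ˣ, (b u : ℂ) / (1 - ω ^ (u : ZMod 3).val) := by
  refine not_exists_lefschetz_of_lt (eval₂_cyclotomic_three_zarhinExample_eq_zero s hδE) hω ?_
  rw [(eigenMultiplicity_zarhinExample_eq_card s hE hδE hω h1).1, dim_zarhinExample, hE, mul_one]
  exact hlt

end ZarhinExample

end AbelianVariety

end Literature.AlgebraicGeometry.HodgeTheory

end
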